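import Summits.AtomisticToContinuum.FouriersLaw.Theses.HonestZwanzig
import Summits.AtomisticToContinuum.FouriersLaw.Theorems.HonestZwanzigRobinCoercivityStubFeshbachIdentities
import Summits.AtomisticToContinuum.FouriersLaw.Theorems.HonestZwanzigNetworkReductionObservables

/-!
# `HonestZwanzig.RobinCoercivity`, line LinAlg — stub `stub_fluxBoundPointwise` (the flux bound at fixed `N`)

Support file (`--supports` the crux `RobinCoercivity`, stmt-AtomisticToContinuum-12695, of route `HonestZwanzig`,
sub-problem `FouriersLaw`). The line reduces the crux to ONE `N`-uniform flux bound (`stub_fluxBound` of the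
skeleton, transferred by the landed `robinCoercivity_of_fluxBound`). This file proves that bound at EACH FIXED
`N ≥ 2`, with an `N`-dependent constant `K = K(N)` and for all `s > 0`: for the pinned anharmonic chain
`pinnedChain ω₂ lam β γ` (all parameters positive), `T > 0`, the canonical gadgets `lap_s` (Laplace transform of the
truncated equilibrium correlation), `cov` (static covariance) and the split site energies `e_x` (abstract, with their
defining equations as hypotheses), whenever the static charge `Σ_y Cov(e_x,e_y) a_y` is the discrete divergence of a
bond flux `ψ` plus contact injections `φ₀, φ₁`,
`Σ_{x,y} a_x lap_s(e_x,e_y) a_y ≤ K (Σ_{b+1<N} ψ_b² + φ₀² + φ₁²)`.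
So the crux holds pointwise in `N`; its only open content is UNIFORMITY in `N`.

Proof. (1) Fixed-`N` exponential mixing (clause (i) of the landed `feshbachIdentities_of`, CEHR Thm 2.13(3)):
`corr(e_x,e_y) ∈ L¹(0,∞)`, whence `|lap_s(e_x,e_y)| ≤ M_{xy} := ∫₀^∞ |corr(e_x,e_y)|` for every `s > 0`
(`0 < e^{-st} ≤ 1`), and `Σ a_x lap_s(e_x,e_y) a_y ≤ (Σ M_{xy}) |a|²`. (2) Conditioning of the static covariance:
`χ = [Cov(e_x,e_y)]` is positive definite (clause (iv-a)), hence `a ↦ χa` is injective, `χ` is invertible and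
`|a|² = |χ⁻¹(χa)|² ≤ (Σ (χ⁻¹)_{xy}²) |χa|²` (Cauchy–Schwarz). (3) The divergence relation bounds
`|χa|² ≤ 3N² (Σ_{b+1<N} ψ_b² + φ₀² + φ₁²)` (crude Cauchy–Schwarz, constants immaterial). (4)
`K := (Σ M)(Σ (χ⁻¹)²)(3N²) + 1`. [folklore]
-/

noncomputable section

open MeasureTheory Finset Matrix
open Literature.MathematicalPhysics.KineticTheory.HeatConduction
open Summit.AtomisticToContinuum.FouriersLaw.Theses.HonestZwanzig

namespace Summit.AtomisticToContinuum.FouriersLaw.Theorems.HonestZwanzig.Robin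

/-! ### Elementary estimates -/

/-- `|∫₀^∞ e^{-st} c(t) dt| ≤ ∫₀^∞ |c(t)| dt` for `c ∈ L¹(0,∞)` and `s ≥ 0`. [folklore] -/
private theorem abs_setIntegral_exp_mul_le {c : ℝ → ℝ} (hc : IntegrableOn c (Set.Ioi 0)) {s : ℝ}
    (hs : 0 ≤ s) :
    |∫ t in Set.Ioi (0 : ℝ), Real.exp (-(s * t)) * c t| ≤ ∫ t in Set.Ioi (0 : ℝ), ‖c t‖ := by
  rw [← Real.norm_eq_abs]
  refine norm_integral_le_of_norm_le (Integrable.norm hc) ?_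
  filter_upwards [ae_restrict_mem measurableSet_Ioi] with t ht
  rw [norm_mul, Real.norm_eq_abs, abs_of_pos (Real.exp_pos _)]
  have h1 : Real.exp (-(s * t)) ≤ 1 := by
    rw [← Real.exp_zero]
    refine Real.exp_le_exp.mpr ?_
    have : 0 ≤ s * t := mul_nonneg hs (le_of_lt ht)
    linarith
  calc Real.exp (-(s * t)) * ‖c t‖ ≤ 1 * ‖c t‖ := mul_le_mul_of_nonneg_right h1 (norm_nonneg _)
    _ = ‖c t‖ := one_mul _

/-- A quadratic form with entrywise bounded coefficients: `Σ a_x L_{xy} a_y ≤ (Σ M_{xy}) |a|²` whenever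
`|L_{xy}| ≤ M_{xy}`. [folklore] -/
private theorem sum_mul_mul_le_of_abs_le {N : ℕ} (L M : Fin N → Fin N → ℝ) (hLM : ∀ x y, |L x y| ≤ M x y)
    (a : Fin N → ℝ) :
    ∑ x, ∑ y, a x * L x y * a y ≤ (∑ x, ∑ y, M x y) * ∑ i, a i ^ 2 := by
  have hsq : ∀ x, a x ^ 2 ≤ ∑ i, a i ^ 2 := fun x =>
    Finset.single_le_sum (f := fun i => a i ^ 2) (fun i _ => sq_nonneg (a i)) (Finset.mem_univ x)
  have key : ∀ x y, a x * L x y * a y ≤ M x y * ∑ i, a i ^ 2 := by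
    intro x y
    have hM : 0 ≤ M x y := (abs_nonneg _).trans (hLM x y)
    have h2 : |a x| * |a y| ≤ ∑ i, a i ^ 2 := by
      nlinarith [sq_nonneg (|a x| - |a y|), sq_abs (a x), sq_abs (a y), hsq x, hsq y,
        abs_nonneg (a x), abs_nonneg (a y)]
    calc a x * L x y * a y ≤ |a x * L x y * a y| := le_abs_self _
      _ = |a x| * |a y| * |L x y| := by rw [abs_mul, abs_mul]; ring
      _ ≤ |a x| * |a y| * M x y := mul_le_mul_of_nonneg_left (hLM x y) (by positivity)
      _ ≤ (∑ i, a i ^ 2) * M x y := mul_le_mul_of_nonneg_right h2 hM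
      _ = M x y * ∑ i, a i ^ 2 := mul_comm _ _
  calc ∑ x, ∑ y, a x * L x y * a y ≤ ∑ x, ∑ y, M x y * ∑ i, a i ^ 2 :=
      Finset.sum_le_sum fun x _ => Finset.sum_le_sum fun y _ => key x y
    _ = (∑ x, ∑ y, M x y) * ∑ i, a i ^ 2 := by
      rw [Finset.sum_mul]
      exact Finset.sum_congr rfl fun x _ => (Finset.sum_mul _ _ _).symm

/-- Conditioning of an injective square matrix: `|a|² ≤ (Σ_{xy} (C⁻¹)_{xy}²) |Ca|²` (Cauchy–Schwarz on
`a = C⁻¹(Ca)`). [folklore] -/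
private theorem sum_sq_le_of_mulVec_injective {n : Type*} [Fintype n] [DecidableEq n] (C : Matrix n n ℝ)
    (hC : Function.Injective C.mulVec) :
    ∃ F : ℝ, 0 ≤ F ∧ ∀ a : n → ℝ, ∑ x, a x ^ 2 ≤ F * ∑ x, (C *ᵥ a) x ^ 2 := by
  have hU : IsUnit C := Matrix.mulVec_injective_iff_isUnit.mp hC
  have hdet : IsUnit C.det := (Matrix.isUnit_iff_isUnit_det C).mp hU
  refine ⟨∑ x, ∑ y, C⁻¹ x y ^ 2,
    Finset.sum_nonneg fun x _ => Finset.sum_nonneg fun y _ => sq_nonneg _, fun a => ?_⟩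
  have ha : C⁻¹ *ᵥ (C *ᵥ a) = a := by
    rw [Matrix.mulVec_mulVec, Matrix.nonsing_inv_mul _ hdet, Matrix.one_mulVec]
  calc ∑ x, a x ^ 2 = ∑ x, (C⁻¹ *ᵥ (C *ᵥ a)) x ^ 2 := by rw [ha]
    _ = ∑ x, (∑ y, C⁻¹ x y * (C *ᵥ a) y) ^ 2 := rfl
    _ ≤ ∑ x, (∑ y, C⁻¹ x y ^ 2) * ∑ y, (C *ᵥ a) y ^ 2 :=
      Finset.sum_le_sum fun x _ => Finset.sum_mul_sq_le_sq_mul_sq _ _ _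
    _ = (∑ x, ∑ y, C⁻¹ x y ^ 2) * ∑ y, (C *ᵥ a) y ^ 2 := by rw [Finset.sum_mul]

/-- One component of the divergence of a bond/contact flux, squared, is at most `3N ×` the dissipation
`Σ_{b+1<N} ψ_b² + φ₀² + φ₁²` (crude Cauchy–Schwarz). [folklore] -/
private theorem div_sq_le {N : ℕ} (hN : 1 ≤ N) (ψ : Fin N → ℝ) (φ₀ φ₁ : ℝ) (x : Fin N) :
    ((∑ b : Fin N, if b.val + 1 < N then
        ((if x.val = b.val + 1 then ψ b else 0) - (if x = b then ψ b else 0)) else 0) +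
      (if x.val = 0 then φ₀ else 0) + (if x.val = N - 1 then φ₁ else 0)) ^ 2 ≤
    3 * N * ((∑ b : Fin N, if b.val + 1 < N then ψ b ^ 2 else 0) + φ₀ ^ 2 + φ₁ ^ 2) := by
  have hΨ0 : 0 ≤ ∑ b : Fin N, if b.val + 1 < N then ψ b ^ 2 else 0 :=
    Finset.sum_nonneg fun b _ => by split_ifs <;> positivity
  have hA : (∑ b : Fin N, if b.val + 1 < N then
        ((if x.val = b.val + 1 then ψ b else 0) - (if x = b then ψ b else 0)) else 0) ^ 2 ≤
      N * ∑ b : Fin N, if b.val + 1 < N then ψ b ^ 2 else 0 := by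
    refine sq_sum_le_card_mul_sum_sq.trans ?_
    rw [Finset.card_univ, Fintype.card_fin]
    exact mul_le_mul_of_nonneg_left
      (Finset.sum_le_sum fun b _ => by split_ifs <;> simp [sq_nonneg]) (Nat.cast_nonneg N)
  have hw : (if x.val = 0 then φ₀ else 0) ^ 2 ≤ φ₀ ^ 2 := by split_ifs <;> simp [sq_nonneg]
  have hz : (if x.val = N - 1 then φ₁ else 0) ^ 2 ≤ φ₁ ^ 2 := by split_ifs <;> simp [sq_nonneg]
  have hN1 : (1 : ℝ) ≤ N := by exact_mod_cast hN
  set A := ∑ b : Fin N, if b.val + 1 < N then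
        ((if x.val = b.val + 1 then ψ b else 0) - (if x = b then ψ b else 0)) else 0
  set w := (if x.val = 0 then φ₀ else 0)
  set z := (if x.val = N - 1 then φ₁ else 0)
  set Ψ := ∑ b : Fin N, if b.val + 1 < N then ψ b ^ 2 else 0
  nlinarith [sq_nonneg (A - w), sq_nonneg (A - z), sq_nonneg (w - z), sq_nonneg φ₀, sq_nonneg φ₁,
    mul_nonneg (sub_nonneg.2 hN1) (add_nonneg (sq_nonneg φ₀) (sq_nonneg φ₁)),
    mul_nonneg (sub_nonneg.2 hN1) hΨ0]

/-- The squared norm of the divergence of a bond/contact flux is at most `3N² ×` its dissipation. [folklore] -/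
private theorem sum_div_sq_le {N : ℕ} (hN : 1 ≤ N) (ψ : Fin N → ℝ) (φ₀ φ₁ : ℝ) :
    ∑ x : Fin N, ((∑ b : Fin N, if b.val + 1 < N then
        ((if x.val = b.val + 1 then ψ b else 0) - (if x = b then ψ b else 0)) else 0) +
      (if x.val = 0 then φ₀ else 0) + (if x.val = N - 1 then φ₁ else 0)) ^ 2 ≤
    3 * N ^ 2 * ((∑ b : Fin N, if b.val + 1 < N then ψ b ^ 2 else 0) + φ₀ ^ 2 + φ₁ ^ 2) := by
  refine (Finset.sum_le_sum fun x _ => div_sq_le hN ψ φ₀ φ₁ x).trans (le_of_eq ?_)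
  rw [Finset.sum_const, Finset.card_univ, Fintype.card_fin, nsmul_eq_mul]
  ring

/-! ### The flux bound from integrable correlations and a positive static covariance -/

/-- **Abstract fixed-`N` flux bound.** If every `lap_s(e_x,e_y)` is the Laplace transform on `(0,∞)` of an
integrable `corr(e_x,e_y)` and the static covariance `[cov(e_x,e_y)]` is positive definite, then there is `K > 0`
with `Σ a_x lap_s(e_x,e_y) a_y ≤ K (Σ_{b+1<N} ψ_b² + φ₀² + φ₁²)` for all `s > 0` and every charge/flux pair
`Σ_y cov(e_x,e_y) a_y = (div ψ)_x + [x=0]φ₀ + [x=N−1]φ₁`. [folklore] -/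
theorem fluxBound_of_integrable_of_pos {N : ℕ} (hN : 2 ≤ N) {X : Type*}
    (lap : ℝ → (X → ℝ) → (X → ℝ) → ℝ) (corr : (X → ℝ) → (X → ℝ) → ℝ → ℝ)
    (cov : (X → ℝ) → (X → ℝ) → ℝ) (e : Fin N → X → ℝ)
    (hlap : ∀ s f g, lap s f g = ∫ t in Set.Ioi (0 : ℝ), Real.exp (-(s * t)) * corr f g t)
    (hint : ∀ x y, IntegrableOn (corr (e x) (e y)) (Set.Ioi 0))
    (hpos : ∀ ξ : Fin N → ℝ, ξ ≠ 0 → 0 < ∑ x, ∑ y, ξ x * cov (e x) (e y) * ξ y) :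
    ∃ K : ℝ, 0 < K ∧ ∀ s : ℝ, 0 < s → ∀ (a ψ : Fin N → ℝ) (φ₀ φ₁ : ℝ),
      (∀ x : Fin N, ∑ y : Fin N, cov (e x) (e y) * a y =
        (∑ b : Fin N, if b.val + 1 < N then
          ((if x.val = b.val + 1 then ψ b else 0) - (if x = b then ψ b else 0)) else 0) +
        (if x.val = 0 then φ₀ else 0) + (if x.val = N - 1 then φ₁ else 0)) →
      ∑ x : Fin N, ∑ y : Fin N, a x * lap s (e x) (e y) * a y ≤
        K * ((∑ b : Fin N, if b.val + 1 < N then ψ b ^ 2 else 0) + φ₀ ^ 2 + φ₁ ^ 2) := by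
  classical
  -- (1) the `s`-uniform bound on the Laplace transforms
  set M : Fin N → Fin N → ℝ := fun x y => ∫ t in Set.Ioi (0 : ℝ), ‖corr (e x) (e y) t‖
  have hM0 : ∀ x y, 0 ≤ M x y := fun x y => integral_nonneg fun t => norm_nonneg _
  have hlapM : ∀ s, 0 < s → ∀ x y, |lap s (e x) (e y)| ≤ M x y := fun s hs x y => by
    rw [hlap]
    exact abs_setIntegral_exp_mul_le (hint x y) hs.le
  set Mt : ℝ := ∑ x, ∑ y, M x y
  have hMt0 : 0 ≤ Mt := Finset.sum_nonneg fun x _ => Finset.sum_nonneg fun y _ => hM0 x y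
  -- (2) conditioning of the static covariance
  set C : Matrix (Fin N) (Fin N) ℝ := Matrix.of fun x y => cov (e x) (e y)
  have hCa : ∀ (ξ : Fin N → ℝ) (x : Fin N), (C *ᵥ ξ) x = ∑ y, cov (e x) (e y) * ξ y := fun ξ x => rfl
  have hquad : ∀ ξ : Fin N → ℝ, ∑ x, ∑ y, ξ x * cov (e x) (e y) * ξ y = ∑ x, ξ x * (C *ᵥ ξ) x := by
    intro ξ
    refine Finset.sum_congr rfl fun x _ => ?_
    rw [hCa, Finset.mul_sum]
    exact Finset.sum_congr rfl fun y _ => by ring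
  have hCinj : Function.Injective C.mulVec := by
    intro a b hab
    by_contra hne
    have h := hpos (a - b) (sub_ne_zero.2 hne)
    rw [hquad, Matrix.mulVec_sub, hab, sub_self] at h
    simp at h
  obtain ⟨F, hF0, hF⟩ := sum_sq_le_of_mulVec_injective C hCinj
  -- (3)+(4) the constant
  refine ⟨Mt * F * (3 * N ^ 2) + 1,
    add_pos_of_nonneg_of_pos (mul_nonneg (mul_nonneg hMt0 hF0) (by positivity)) one_pos,
    fun s hs a ψ φ₀ φ₁ hdiv => ?_⟩
  have hS0 : 0 ≤ (∑ b : Fin N, if b.val + 1 < N then ψ b ^ 2 else 0) + φ₀ ^ 2 + φ₁ ^ 2 :=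
    add_nonneg (add_nonneg (Finset.sum_nonneg fun b _ => by split_ifs <;> positivity) (sq_nonneg _))
      (sq_nonneg _)
  have hCa2 : ∑ x, (C *ᵥ a) x ^ 2 ≤
      3 * N ^ 2 * ((∑ b : Fin N, if b.val + 1 < N then ψ b ^ 2 else 0) + φ₀ ^ 2 + φ₁ ^ 2) := by
    have h1 : ∀ x, (C *ᵥ a) x = (∑ b : Fin N, if b.val + 1 < N then
          ((if x.val = b.val + 1 then ψ b else 0) - (if x = b then ψ b else 0)) else 0) +
        (if x.val = 0 then φ₀ else 0) + (if x.val = N - 1 then φ₁ else 0) := fun x => by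
      rw [hCa, hdiv x]
    simp_rw [h1]
    exact sum_div_sq_le (by omega) ψ φ₀ φ₁
  have ha2 : ∑ x, a x ^ 2 ≤
      F * (3 * N ^ 2 * ((∑ b : Fin N, if b.val + 1 < N then ψ b ^ 2 else 0) + φ₀ ^ 2 + φ₁ ^ 2)) :=
    (hF a).trans (mul_le_mul_of_nonneg_left hCa2 hF0)
  have hq : ∑ x, ∑ y, a x * lap s (e x) (e y) * a y ≤ Mt * ∑ x, a x ^ 2 :=
    sum_mul_mul_le_of_abs_le (fun x y => lap s (e x) (e y)) M (hlapM s hs) a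
  calc ∑ x, ∑ y, a x * lap s (e x) (e y) * a y ≤ Mt * ∑ x, a x ^ 2 := hq
    _ ≤ Mt * (F * (3 * N ^ 2 *
        ((∑ b : Fin N, if b.val + 1 < N then ψ b ^ 2 else 0) + φ₀ ^ 2 + φ₁ ^ 2))) :=
      mul_le_mul_of_nonneg_left ha2 hMt0
    _ = (Mt * F * (3 * N ^ 2)) * ((∑ b : Fin N, if b.val + 1 < N then ψ b ^ 2 else 0) + φ₀ ^ 2 + φ₁ ^ 2) := by
      ring
    _ ≤ (Mt * F * (3 * N ^ 2) + 1) *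
        ((∑ b : Fin N, if b.val + 1 < N then ψ b ^ 2 else 0) + φ₀ ^ 2 + φ₁ ^ 2) := by
      nlinarith [hS0]

/-! ### The stub -/

/-- **Stub `stub_fluxBoundPointwise` of line `LinAlg`, crux `RobinCoercivity` (stmt-AtomisticToContinuum-12695): the
flux bound at FIXED `N` with an `N`-dependent constant, for all `s > 0`.** For `pinnedChain ω₂ lam β γ` (all
parameters positive), `T > 0`, `N ≥ 2` and the canonical gadgets `lap, cov, e` (abstract, with defining equations):
there is `K = K(N) > 0` such that `Σ_{x,y} a_x lap_s(e_x,e_y) a_y ≤ K (Σ_{b+1<N} ψ_b² + φ₀² + φ₁²)` whenever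
`Σ_y Cov(e_x,e_y) a_y = Σ_{b+1<N}([x=b+1] − [x=b])ψ_b + [x=0]φ₀ + [x=N−1]φ₁`. From fixed-`N` exponential mixing
(`corr(e_x,e_y) ∈ L¹(0,∞)`, clause (i) of `feshbachIdentities_of`) and positive definiteness of `Cov(e,e)` (clause
(iv-a)) through `fluxBound_of_integrable_of_pos`: the crux holds pointwise in `N`, only `N`-uniformity is open.
[cite: CuneoEckmannHairerReyBellet2018, Thm 2.13 (3)] -/
theorem stub_fluxBoundPointwise {ω₂ lam β γ : ℝ} {N : ℕ} {T : ℝ} (hω : 0 < ω₂) (hl : 0 < lam) (hβ : 0 < β)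
    (hγ : 0 < γ) (hT : 0 < T) (hN : 2 ≤ N)
    (lap : ℝ → (PhaseSpace N → ℝ) → (PhaseSpace N → ℝ) → ℝ)
    (cov : (PhaseSpace N → ℝ) → (PhaseSpace N → ℝ) → ℝ) (e : Fin N → PhaseSpace N → ℝ)
    (hlap : ∀ s f g, lap s f g = ∫ t in Set.Ioi (0 : ℝ), Real.exp (-(s * t)) *
      ((∫ z, f z * (∫ y, g y ∂((pinnedChain ω₂ lam β γ).transitionKernel N T T t.toNNReal z))
          ∂(pinnedChain ω₂ lam β γ).gibbsMeasure N T) -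
        (∫ z, f z ∂(pinnedChain ω₂ lam β γ).gibbsMeasure N T) *
          (∫ z, g z ∂(pinnedChain ω₂ lam β γ).gibbsMeasure N T)))
    (hcov : ∀ f g, cov f g = (∫ z, f z * g z ∂(pinnedChain ω₂ lam β γ).gibbsMeasure N T) -
      (∫ z, f z ∂(pinnedChain ω₂ lam β γ).gibbsMeasure N T) *
        (∫ z, g z ∂(pinnedChain ω₂ lam β γ).gibbsMeasure N T))
    (he : ∀ x z, e x z = z.2 x ^ 2 / 2 + (pinnedChain ω₂ lam β γ).U (z.1 x) +
      ∑ j : Fin N, ((if j.val = x.val + 1 then (pinnedChain ω₂ lam β γ).V (z.1 j - z.1 x) / 2 else 0) +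
        (if x.val = j.val + 1 then (pinnedChain ω₂ lam β γ).V (z.1 x - z.1 j) / 2 else 0))) :
    ∃ K : ℝ, 0 < K ∧ ∀ s : ℝ, 0 < s → ∀ (a ψ : Fin N → ℝ) (φ₀ φ₁ : ℝ),
      (∀ x : Fin N, ∑ y : Fin N, cov (e x) (e y) * a y =
        (∑ b : Fin N, if b.val + 1 < N then
          ((if x.val = b.val + 1 then ψ b else 0) - (if x = b then ψ b else 0)) else 0) +
        (if x.val = 0 then φ₀ else 0) + (if x.val = N - 1 then φ₁ else 0)) →
      ∑ x : Fin N, ∑ y : Fin N, a x * lap s (e x) (e y) * a y ≤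
        K * ((∑ b : Fin N, if b.val + 1 < N then ψ b ^ 2 else 0) + φ₀ ^ 2 + φ₁ ^ 2) := by
  -- the truncated equilibrium correlation and the admissible class of the route
  set corr : (PhaseSpace N → ℝ) → (PhaseSpace N → ℝ) → ℝ → ℝ := fun f g t =>
    (∫ z, f z * (∫ y, g y ∂((pinnedChain ω₂ lam β γ).transitionKernel N T T t.toNNReal z))
      ∂(pinnedChain ω₂ lam β γ).gibbsMeasure N T) -
    (∫ z, f z ∂(pinnedChain ω₂ lam β γ).gibbsMeasure N T) *
      (∫ z, g z ∂(pinnedChain ω₂ lam β γ).gibbsMeasure N T) with hcorr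
  set Adm : (PhaseSpace N → ℝ) → Prop := fun f => Continuous f ∧ ∃ A : ℝ, ∀ z,
    |f z| ≤ A * Real.exp ((pinnedChain ω₂ lam β γ).hamiltonian N z / (8 * T)) with hAdm
  have hlap' : ∀ s f g, lap s f g = ∫ t in Set.Ioi (0 : ℝ), Real.exp (-(s * t)) * corr f g t := hlap
  -- the fixed-`N` package: integrable correlations of admissible observables, `Cov(e,e) > 0`
  obtain ⟨-, hFI, hCp, -⟩ := feshbachIdentities_of hω hl.le hβ hγ hN hT e he Adm hAdm corr hcorr lap
    (funext fun s => funext fun f => funext fun g => hlap' s f g) cov (funext fun f => funext fun g => hcov f g)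
    (fun s => Matrix.of fun x y => lap s (e x) (e y)) rfl
  have hex : ∀ x, Adm (e x) := fun x =>
    NetworkReduction.adm_e Adm (fun f => by rw [hAdm]) e he hω hl.le hβ.le hT x
  exact fluxBound_of_integrable_of_pos hN lap corr cov e hlap'
    (fun x y => (hFI (e x) (e y) (hex x) (hex y)).2.2.1) hCp

end Summit.AtomisticToContinuum.FouriersLaw.Theorems.HonestZwanzig.Robin

end
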